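import Mathlib
import HarnessLib.Audit
import Summits.PneNP.PneNP.Theorems.PstarUnionTrichotomy
import Summits.PneNP.PneNP.Theorems.PstarFreshErase

/-!
# The abstract first rungs of the pin calculus: no free chord, pinned readers make chords hard, Case A (ROUND-24, memo §14.13 PC2–PC3; ASK T-UNION-TRI (2))

FRONTIER range-avoidance ladder, rung F-N3, ROUND 24 (cell `pnp-ideate`, planner memo `r24/CORE-BOUND-NOTES.md` §14.13, typed sketch `r24/SketchAtoms.lean` of planner
p3 g22 — definitions and statements VERBATIM; restricted-model proof complexity — nothing here bears on `P` versus `NP`).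

* `xvars`, `Untouched` — p3's vocabulary;
* `satPair_of_erase_chord` — **A3, NO FREE CHORD**: if neither `A` nor `w₂` touches the privates of a chord `c`, a solution of `J₀ − c` repairs to one of `J₀`
  (`PstarUnion.satPair_of_free_andPair`);
* `hard_of_pinned_read` — **A2**: `w₂` untouched on `c`'s privates, a reader `φ` touching them only linearly and reading at least one, `φ` constant on
  `Z = Sol(J₀) ∩ {w₂}` ⟹ `m_c ≡ 1` on `Z` (the three points `(0,0), (1,0), (0,1)` of the private pair all lie in `Z` and `φ` separates two of them);
* `caseA_hard` — **A4, CASE A**: union-terminal + hun + `w₂` chord-blind ⟹ every chord monomial is `1` on `Z`;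
* `CaseAFive`, `CaseATrichotomy` (OPEN, `@[conjecture]`) — the Case-A targets, where expansion enters (PC4–PC5).

A1 (chords absorb, the forest induction) is `PstarUnionAbsorb.solF_extend`.
-/

set_option linter.dupNamespace false -- `Summit.PneNP.PneNP.…`: summit = sub-problem name (D-0017 single-conjunct layout)

open Finset Literature.Computability.Complexity
open Summit.PneNP.PneNP.Theorems.PstarFibrePolys (bit bit_injective)
open Summit.PneNP.PneNP.Theorems.PstarTyped (Typed)
open Summit.PneNP.PneNP.Theorems.PstarSALevel (varSet bdry BoundaryExpanding SimpleOverlap)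
open Summit.PneNP.PneNP.Theorems.PstarGapPeeling (not_mem_varSet_of_private eval_update_of_not_mem)
open Summit.PneNP.PneNP.Theorems.PstarCentreFree (vars_mem_varSet)
open Summit.PneNP.PneNP.Theorems.PstarGapOneAll (gval)
open Summit.PneNP.PneNP.Theorems.PstarGConstraint (gval_update_of_forall_ne)
open Summit.PneNP.PneNP.Theorems.PstarCoreBound (XorClosed)
open Summit.PneNP.PneNP.Theorems.PstarChordRepair (IsChord)
open Summit.PneNP.PneNP.Theorems.PstarChordBridgeCotree (Peelable)
open Summit.PneNP.PneNP.Theorems.PstarChordBridgeTools (privs mem_privs)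
open Summit.PneNP.PneNP.Theorems.PstarUnion (SatPair UnionTerminal UnionFive satPair_of_free_andPair)
open Summit.PneNP.PneNP.Theorems.PstarUnionPin (pinK)
open Summit.PneNP.PneNP.Theorems.PstarUnionTrichotomy (UnionTrichotomy)
open Summit.PneNP.PneNP.Theorems.PstarFreshErase (bit_gval_update_lin)

namespace Summit.PneNP.PneNP.Theorems.PstarUnionAtoms

variable {n m : ℕ}

/-- the XOR-slot variables of the outputs of `J` -/
def xvars (I : LocalMap 4 n m) (J : Finset (Fin m)) : Finset (Fin n) := J.biUnion fun j => {I.vars j 0, I.vars j 1}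

/-- a constraint `A = (C, G, t)` does not touch the variable `v` at all (neither linearly nor through a monomial) -/
def Untouched (I : LocalMap 4 n m) (A : Finset (Fin n) × Finset (Fin m) × Bool) (v : Fin n) : Prop :=
  v ∉ A.1 ∧ ∀ g ∈ A.2.1, I.vars g 2 ≠ v ∧ I.vars g 3 ≠ v

/-! ## A3 — no free chord -/

/-- **A3 — NO FREE CHORD (PC3).**  If neither `A` nor `w₂` touches the privates of the chord `c`, a solution of `J₀ − c` with `A ∧ w₂` can be
repaired on `(a_c, b_c)` into a solution of `J₀` with `A ∧ w₂`. -/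
theorem satPair_of_erase_chord (I : LocalMap 4 n m) (hI : I.IsPure xorAndPred) {y : Fin m → Bool} {J₀ : Finset (Fin m)} {c : Fin m}
    (hc : c ∈ J₀) (hch : IsChord I J₀ c) (A w₂ : Finset (Fin n) × Finset (Fin m) × Bool)
    (hA : Untouched I A (I.vars c 2) ∧ Untouched I A (I.vars c 3)) (hw : Untouched I w₂ (I.vars c 2) ∧ Untouched I w₂ (I.vars c 3))
    (h : SatPair I y (J₀.erase c) A w₂) : SatPair I y J₀ A w₂ := by
  have hinj := hI.2 c
  have hs : ∀ s : Fin 4, 2 ≤ s.val → s = 2 ∨ s = 3 := by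
    intro s hs
    rcases s with ⟨_ | _ | _ | _ | k, hk⟩
    · exact absurd hs (by simp)
    · exact absurd hs (by simp)
    · exact Or.inl rfl
    · exact Or.inr rfl
    · omega
  refine satPair_of_free_andPair I hI y hc (fun h => absurd (hinj h) (by decide)) ?_ ?_ ?_ ?_ h
  · intro s hs' j hj hjc
    rcases hs s hs' with rfl | rfl
    · exact not_mem_varSet_of_private I hc hj hjc hch.1 (vars_mem_varSet I c 2)
    · exact not_mem_varSet_of_private I hc hj hjc hch.2 (vars_mem_varSet I c 3)
  · intro s hs'
    rcases hs s hs' with rfl | rfl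
    · exact ⟨fun h => absurd (hinj h) (by decide), fun h => absurd (hinj h) (by decide)⟩
    · exact ⟨fun h => absurd (hinj h) (by decide), fun h => absurd (hinj h) (by decide)⟩
  · intro s hs'
    rcases hs s hs' with rfl | rfl
    · exact ⟨hA.1.1, hw.1.1⟩
    · exact ⟨hA.2.1, hw.2.1⟩
  · intro g hg s s' hs₁ hs₂
    have hgA : g ∈ A.2.1 ∨ g ∈ w₂.2.1 := mem_union.1 hg
    rcases hs s hs₁ with rfl | rfl <;> rcases hs s' hs₂ with rfl | rfl
    · rcases hgA with h | h
      · exact (hA.1.2 g h).1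
      · exact (hw.1.2 g h).1
    · rcases hgA with h | h
      · exact (hA.1.2 g h).2
      · exact (hw.1.2 g h).2
    · rcases hgA with h | h
      · exact (hA.2.2 g h).1
      · exact (hw.2.2 g h).1
    · rcases hgA with h | h
      · exact (hA.2.2 g h).2
      · exact (hw.2.2 g h).2

/-! ## A2 — a pinned linear reader makes the chord hard -/

/-- Setting the private pair of a chord to values with product `0` keeps every other output and, if the product was `0`, the chord itself. -/
theorem eval_setPair (I : LocalMap 4 n m) (hI : I.IsPure xorAndPred) {y : Fin m → Bool} {J₀ : Finset (Fin m)} {c : Fin m} (hc : c ∈ J₀)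
    (hch : IsChord I J₀ c) {x : Fin n → Bool} (hx : ∀ j ∈ J₀, I.eval x j = y j) (hprod : (x (I.vars c 2) && x (I.vars c 3)) = false)
    (a b : Bool) (hab : (a && b) = false) :
    ∀ j ∈ J₀, I.eval (Function.update (Function.update x (I.vars c 2) a) (I.vars c 3) b) j = y j := by
  intro j hj
  have hinj := hI.2 c
  by_cases hjc : j = c
  · subst hjc
    rw [PstarGapPeeling.eval_pure I hI] at *
    have h23 : I.vars j 2 ≠ I.vars j 3 := fun h => absurd (hinj h) (by decide)
    have h02 : I.vars j 0 ≠ I.vars j 2 := fun h => absurd (hinj h) (by decide)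
    have h03 : I.vars j 0 ≠ I.vars j 3 := fun h => absurd (hinj h) (by decide)
    have h12 : I.vars j 1 ≠ I.vars j 2 := fun h => absurd (hinj h) (by decide)
    have h13 : I.vars j 1 ≠ I.vars j 3 := fun h => absurd (hinj h) (by decide)
    have hx' := hx j hj
    rw [PstarGapPeeling.eval_pure I hI] at hx'
    simp only [Function.update_self, Function.update_of_ne h03, Function.update_of_ne h02, Function.update_of_ne h13, Function.update_of_ne h12,
      Function.update_of_ne h23]
    rw [hab]
    rw [hprod] at hx'
    exact hx'
  · rw [eval_update_of_not_mem I j _ (not_mem_varSet_of_private I hc hj hjc hch.2 (vars_mem_varSet I c 3)),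
      eval_update_of_not_mem I j _ (not_mem_varSet_of_private I hc hj hjc hch.1 (vars_mem_varSet I c 2))]
    exact hx j hj

/-- An untouched constraint does not see the private pair. -/
theorem gval_setPair (I : LocalMap 4 n m) {c : Fin m} {w : Finset (Fin n) × Finset (Fin m) × Bool}
    (hw : Untouched I w (I.vars c 2) ∧ Untouched I w (I.vars c 3)) (x : Fin n → Bool) (a b : Bool) :
    gval I w.1 w.2.1 (Function.update (Function.update x (I.vars c 2) a) (I.vars c 3) b) = gval I w.1 w.2.1 x := by
  rw [gval_update_of_forall_ne I _ hw.2.1 hw.2.2, gval_update_of_forall_ne I _ hw.1.1 hw.1.2]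

/-- **A2 — A PINNED LINEAR READER MAKES THE CHORD HARD (PC2).** -/
theorem hard_of_pinned_read (I : LocalMap 4 n m) (hI : I.IsPure xorAndPred) {y : Fin m → Bool} {J₀ : Finset (Fin m)} {c : Fin m}
    (hc : c ∈ J₀) (hch : IsChord I J₀ c) (w₂ φ : Finset (Fin n) × Finset (Fin m) × Bool)
    (hw : Untouched I w₂ (I.vars c 2) ∧ Untouched I w₂ (I.vars c 3))
    (hφ : ∀ g ∈ φ.2.1, I.vars g 2 ≠ I.vars c 2 ∧ I.vars g 3 ≠ I.vars c 2 ∧ I.vars g 2 ≠ I.vars c 3 ∧ I.vars g 3 ≠ I.vars c 3)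
    (hread : I.vars c 2 ∈ φ.1 ∨ I.vars c 3 ∈ φ.1)
    (hpin : ∀ x x' : Fin n → Bool, (∀ j ∈ J₀, I.eval x j = y j) → gval I w₂.1 w₂.2.1 x = w₂.2.2 →
      (∀ j ∈ J₀, I.eval x' j = y j) → gval I w₂.1 w₂.2.1 x' = w₂.2.2 → gval I φ.1 φ.2.1 x = gval I φ.1 φ.2.1 x')
    {x : Fin n → Bool} (hx : ∀ j ∈ J₀, I.eval x j = y j) (hxw : gval I w₂.1 w₂.2.1 x = w₂.2.2) :
    x (I.vars c 2) = true ∧ x (I.vars c 3) = true := by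
  by_contra hnot
  have hprod : (x (I.vars c 2) && x (I.vars c 3)) = false := by
    revert hnot; cases x (I.vars c 2) <;> cases x (I.vars c 3) <;> simp
  have h23 : I.vars c 2 ≠ I.vars c 3 := fun h => absurd (hI.2 c h) (by decide)
  -- the three points of the private pair with product zero
  let P : Bool → Bool → (Fin n → Bool) := fun a b => Function.update (Function.update x (I.vars c 2) a) (I.vars c 3) b
  have hZ : ∀ a b, (a && b) = false → (∀ j ∈ J₀, I.eval (P a b) j = y j) ∧ gval I w₂.1 w₂.2.1 (P a b) = w₂.2.2 :=
    fun a b hab => ⟨eval_setPair I hI hc hch hx hprod a b hab, by rw [gval_setPair I hw]; exact hxw⟩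
  -- `φ` on these points
  have hG : ∀ g ∈ φ.2.1, (I.vars g 2 ≠ I.vars c 2 ∧ I.vars g 3 ≠ I.vars c 2) ∧ (I.vars g 2 ≠ I.vars c 3 ∧ I.vars g 3 ≠ I.vars c 3) :=
    fun g hg => ⟨⟨(hφ g hg).1, (hφ g hg).2.1⟩, ⟨(hφ g hg).2.2.1, (hφ g hg).2.2.2⟩⟩
  have hval : ∀ a b, bit (gval I φ.1 φ.2.1 (P a b)) = bit (gval I φ.1 φ.2.1 x) +
      (if I.vars c 3 ∈ φ.1 then bit b + bit (x (I.vars c 3)) else 0) + (if I.vars c 2 ∈ φ.1 then bit a + bit (x (I.vars c 2)) else 0) := by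
    intro a b
    show bit (gval I φ.1 φ.2.1 (Function.update (Function.update x (I.vars c 2) a) (I.vars c 3) b)) = _
    rw [bit_gval_update_lin I φ.1 _ (fun g hg => (hG g hg).2), bit_gval_update_lin I φ.1 _ (fun g hg => (hG g hg).1),
      Function.update_of_ne h23.symm]
    ring
  have e00_10 := hpin _ _ (hZ false false (by decide)).1 (hZ false false (by decide)).2 (hZ true false (by decide)).1 (hZ true false (by decide)).2
  have e00_01 := hpin _ _ (hZ false false (by decide)).1 (hZ false false (by decide)).2 (hZ false true (by decide)).1 (hZ false true (by decide)).2
  have b1 := congrArg bit e00_10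
  have b2 := congrArg bit e00_01
  rw [hval, hval] at b1 b2
  have hne : bit false ≠ bit true := by decide
  by_cases h2 : I.vars c 2 ∈ φ.1
  · rw [if_pos h2, if_pos h2] at b1
    exact hne (by linear_combination b1)
  · have h3 : I.vars c 3 ∈ φ.1 := hread.resolve_left h2
    rw [if_pos h3, if_pos h3] at b2
    exact hne (by linear_combination b2)

/-! ## A4 — Case A: every chord is hard -/

/-- **A4 — CASE A: EVERY CHORD IS HARD.**  In a union-terminal core whose monomials avoid the chord privates (hun) and whose shared
constraint `w₂` does not even read them linearly, every chord monomial is `1` on `Z`. -/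
theorem caseA_hard (I : LocalMap 4 n m) (hI : I.IsPure xorAndPred) (_hT : Typed I) (_hS : SimpleOverlap I) {r : ℕ}
    {y : Fin m → Bool} {J₀ : Finset (Fin m)} {A₀ A₁ w₂ : Finset (Fin n) × Finset (Fin m) × Bool} (hU : UnionTerminal I r y J₀ A₀ A₁ w₂)
    {F : Finset (Fin m)} (_hF : F ⊆ J₀) (hchord : ∀ e ∈ J₀ \ F, IsChord I J₀ e)
    (hun : ∀ g ∈ A₀.2.1 ∪ w₂.2.1, ∀ v ∈ privs I (J₀ \ F), I.vars g 2 ≠ v ∧ I.vars g 3 ≠ v)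
    (hblind : ∀ v ∈ privs I (J₀ \ F), v ∉ w₂.1)
    {c : Fin m} (hc : c ∈ J₀ \ F) {x : Fin n → Bool} (hx : ∀ j ∈ J₀, I.eval x j = y j) (hxw : gval I w₂.1 w₂.2.1 x = w₂.2.2) :
    x (I.vars c 2) = true ∧ x (I.vars c 3) = true := by
  obtain ⟨-, -, -, hG, -, -, -, -, h₀, h₁, hcov⟩ := id hU
  have hcJ : c ∈ J₀ := (mem_sdiff.1 hc).1
  have hch := hchord c hc
  have hp2 : I.vars c 2 ∈ privs I (J₀ \ F) := (mem_privs I).2 ⟨c, hc, Or.inl rfl⟩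
  have hp3 : I.vars c 3 ∈ privs I (J₀ \ F) := (mem_privs I).2 ⟨c, hc, Or.inr rfl⟩
  -- `w₂` is untouched on the privates; the monomials of `A₀ = A₁` avoid them
  have hw : Untouched I w₂ (I.vars c 2) ∧ Untouched I w₂ (I.vars c 3) :=
    ⟨⟨hblind _ hp2, fun g hg => hun g (mem_union_right _ hg) _ hp2⟩, ⟨hblind _ hp3, fun g hg => hun g (mem_union_right _ hg) _ hp3⟩⟩
  have hmono : ∀ A : Finset (Fin n) × Finset (Fin m) × Bool, A.2.1 = A₀.2.1 →
      ∀ g ∈ A.2.1, I.vars g 2 ≠ I.vars c 2 ∧ I.vars g 3 ≠ I.vars c 2 ∧ I.vars g 2 ≠ I.vars c 3 ∧ I.vars g 3 ≠ I.vars c 3 := by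
    intro A hA g hg
    rw [hA] at hg
    exact ⟨(hun g (mem_union_left _ hg) _ hp2).1, (hun g (mem_union_left _ hg) _ hp2).2, (hun g (mem_union_left _ hg) _ hp3).1,
      (hun g (mem_union_left _ hg) _ hp3).2⟩
  -- the covering constraint reads a private of `c` (A3) and is constant on `Z` (infeasibility), so A2 applies
  have key : ∀ A : Finset (Fin n) × Finset (Fin m) × Bool, A.2.1 = A₀.2.1 → ¬ SatPair I y J₀ A w₂ → SatPair I y (J₀.erase c) A w₂ →
      x (I.vars c 2) = true ∧ x (I.vars c 3) = true := by
    intro A hA hinf hsat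
    have hread : I.vars c 2 ∈ A.1 ∨ I.vars c 3 ∈ A.1 := by
      by_contra hno
      rw [not_or] at hno
      have hAun : Untouched I A (I.vars c 2) ∧ Untouched I A (I.vars c 3) :=
        ⟨⟨hno.1, fun g hg => ⟨(hmono A hA g hg).1, (hmono A hA g hg).2.1⟩⟩, ⟨hno.2, fun g hg => ⟨(hmono A hA g hg).2.2.1, (hmono A hA g hg).2.2.2⟩⟩⟩
      exact hinf (satPair_of_erase_chord I hI hcJ hch A w₂ hAun hw hsat)
    refine hard_of_pinned_read I hI hcJ hch w₂ A hw (hmono A hA) hread (fun z z' hz hzw hz' hz'w => ?_) hx hxw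
    -- `A` is constant on `Z`: it never hits its target there
    have e : ∀ a b t : Bool, a ≠ t → b ≠ t → a = b := by decide
    exact e _ _ A.2.2 (fun h => hinf ⟨z, hz, h, hzw⟩) (fun h => hinf ⟨z', hz', h, hz'w⟩)
  rcases hcov c hcJ with h | h
  · exact key A₀ rfl h₀ h
  · exact key A₁ hG h₁ h

/-! ## The Case-A targets -/

/-- **CASE-A TARGET (OPEN; PC4–PC5, expansion enters here).**  Union-terminal + admissible `F` + hun + `w₂` chord-blind ⟹ `#J₀ ≤ 5`.  FRONTIER. -/
@[conjecture] def CaseAFive : Prop :=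
  ∀ (n m r : ℕ) (I : LocalMap 4 n m), I.IsPure xorAndPred → Typed I → SimpleOverlap I → BoundaryExpanding r I →
  ∀ (y : Fin m → Bool) (J₀ : Finset (Fin m)) (A₀ A₁ w₂ : Finset (Fin n) × Finset (Fin m) × Bool),
    UnionTerminal I r y J₀ A₀ A₁ w₂ →
    ∀ F ⊆ J₀, Peelable I F → (∀ F', F ⊆ F' → F' ⊆ J₀ → Peelable I F' → F' = F) → (∀ e ∈ J₀ \ F, IsChord I J₀ e) →
    (∀ g ∈ A₀.2.1 ∪ w₂.2.1, ∀ v ∈ privs I (J₀ \ F), I.vars g 2 ≠ v ∧ I.vars g 3 ≠ v) →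
    (∀ v ∈ privs I (J₀ \ F), v ∉ w₂.1) →
    J₀.card ≤ 5

/-- **CASE-A TRICHOTOMY (OPEN)** — the same regime; implies `CaseAFive` by the glue of `PstarUnionTrichotomy`.  FRONTIER. -/
@[conjecture] def CaseATrichotomy : Prop :=
  ∀ (n m r : ℕ) (I : LocalMap 4 n m), I.IsPure xorAndPred → Typed I → SimpleOverlap I → BoundaryExpanding r I →
  ∀ (y : Fin m → Bool) (J₀ : Finset (Fin m)) (A₀ A₁ w₂ : Finset (Fin n) × Finset (Fin m) × Bool),
    UnionTerminal I r y J₀ A₀ A₁ w₂ →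
    ∀ F ⊆ J₀, Peelable I F → (∀ F', F ⊆ F' → F' ⊆ J₀ → Peelable I F' → F' = F) → (∀ e ∈ J₀ \ F, IsChord I J₀ e) →
    (∀ g ∈ A₀.2.1 ∪ w₂.2.1, ∀ v ∈ privs I (J₀ \ F), I.vars g 2 ≠ v ∧ I.vars g 3 ≠ v) →
    (∀ v ∈ privs I (J₀ \ F), v ∉ w₂.1) →
    (∀ f ∈ J₀, SatPair I y (J₀.erase f) A₀ w₂) ∨ (∀ f ∈ J₀, SatPair I y (J₀.erase f) A₁ w₂) ∨
    (∀ f ∈ J₀, SatPair I y (J₀.erase f) (pinK A₀ A₁) w₂)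

/-- `CaseATrichotomy ⟹ CaseAFive` (the glue of `PstarUnionTrichotomy`, restricted). -/
theorem caseAFive_of_caseATrichotomy (h : CaseATrichotomy) : CaseAFive := by
  intro n m r I hI hT hS hB y J₀ A₀ A₁ w₂ hU F hF hP hmax hchord hun hblind
  have hG : A₁.2.1 = A₀.2.1 := hU.2.2.2.1
  rcases h n m r I hI hT hS hB y J₀ A₀ A₁ w₂ hU F hF hP hmax hchord hun hblind with h₀ | h₁ | hR
  · exact PstarCoreBoundTargets.card_le_five_of_terminal' I hI hT hS hB y (PstarUnionTrichotomy.terminal_of_cover₀ I hU h₀) hF hP hmax hchord hun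
  · refine PstarCoreBoundTargets.card_le_five_of_terminal' I hI hT hS hB y (PstarUnionTrichotomy.terminal_of_cover₁ I hU h₁) hF hP hmax hchord ?_
    rw [hG]; exact hun
  · exact PstarUnionPin.card_le_five_of_released I hI hT hS hB hU hR hF hP hmax hchord fun g hg => hun g (mem_union_right _ hg)

end Summit.PneNP.PneNP.Theorems.PstarUnionAtoms
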